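import Literature.NumberTheory.Automorphic.HermitianLatticeTreeEulerRelation          -- ★ (T3) `natCard_fixedBy_add_eq_natCard_fixedBy_inf_add_one`
import Literature.NumberTheory.Automorphic.UnitaryUnitOrbitalIntegralLatticeCount     -- ★ `natCard_fixedBy_quotient_congr`, `exists_equiv_fixedBy_quotient_congr`
import HarnessLib

/-!
# The elliptic Euler–Poincaré relation TRANSPORTED to any model `e : G ≃* U(σ, H)` of the unitary group, with the three levels given by
# membership tests (`g ∈ C ↔ e g ∈ GL₂(𝒪)`, `g ∈ C′ ↔ e g ∈ g₁ GL₂(𝒪) g₁⁻¹`, `g ∈ I ↔ g ∈ C ∧ g ∈ C′`) (Kottwitz 1988 §2; Kottwitz 1986 §3)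

Topic `NumberTheory/Automorphic`; namespace `Literature.NumberTheory.Automorphic.HermitianLatticeTree`.  THEOREMS ONLY (no definition, no instance, no notation, no named
fact, no `sorry`).  Part (T4) of the lattice-tree road: cell `pub/hodgecm-mathlib` (D-0151), crux H413 (stmt-HodgeConjecture-24833), line «N6nsGerm», the Euler–Poincaré
letter (R2) `stub_N6nsR2EP : RankOneEulerPoincareNonsplit`.  The consumer (the (R2) assembly on the CM carrier `U₂ = (UnitaryGroup.cmDatum L 2 Φ₂).Local v`, glue ★
`Rogawski1990/RankOneEulerPoincareGlue`, B-p14 (g32); B-p10 (g25)'s hypothesis form `(C C′ I : Subgroup U₂) (hC : g ∈ C ↔ ↑(e g) ∈ glInt 2 L_w) (hC′ : … ∈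
(glInt 2 L_w).map (conj g₁)) …`) reads the relation through the one-place isomorphism `e = localNonsplitEquiv … : U₂ ≃* ↥(unitaryGroupOfForm σ_w (Φ₂)_w)`; this file
does that transport once and for all, for ANY group isomorphism `e : G ≃* ↥(unitaryGroupOfForm σ H)` (A-p17 (g22); LEAD F0P3a-plan (g10) WORDS T9-6 ∕ T9-8).
HONEST LABEL: HC_CM is proved only modulo the printed citations until rung 0 closes; nothing printed is asserted here.

* `finite_fixedBy_quotient_congr` — finiteness of `Fix_γ(G ⧸ C)` transports to `Fix_{eγ}(U ⧸ K)`;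
* `finite_range_pow_quotient_congr` — finiteness of the `⟨γ⟩`-orbit of the base coset transports;
* **`natCard_fixedBy_add_eq_natCard_fixedBy_add_one_congr`** — `#Fix_γ(G⧸C) + #Fix_γ(G⧸C′) = #Fix_γ(G⧸I) + 1` on the model `G`, from ★ (T3) and ★
  `natCard_fixedBy_quotient_congr`, under the (T3) hypotheses (transitivity `hA hB hI`, the base edge `g₁`) and the finiteness inputs stated on `G`.

References: [Kottwitz1988] R. E. Kottwitz, *Tamagawa numbers*, Ann. of Math. 127 (1988), §2; [Kottwitz1986] R. E. Kottwitz, Compositio Math. 60 (1986), §3;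
[Serre1980Trees] J.-P. Serre, *Trees* (1980), I.6.1, II.1.1; [Rogawski1990] J. D. Rogawski, Ann. of Math. Stud. 123 (1990), §12.2 p. 176.
-/

set_option autoImplicit false

noncomputable section

open scoped ValuativeRel Matrix MatrixGroups
open Matrix ValuativeRel

namespace Literature.NumberTheory.Automorphic.HermitianLatticeTree

variable {E : Type*} [Field E] [ValuativeRel E]

section Congr

variable {G : Type*} [Group G] {G' : Type*} [Group G'] (C : Subgroup G) (K : Subgroup G') (e : G ≃* G')

/-- Finiteness of fixed cosets transports along `e : G ≃* G′` with `g ∈ C ↔ e g ∈ K`. [cite: Kottwitz1986, §3] -/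
theorem finite_fixedBy_quotient_congr (hK : ∀ g : G, g ∈ C ↔ e g ∈ K) (γ : G) (hfin : (MulAction.fixedBy (G ⧸ C) γ).Finite) :
    (MulAction.fixedBy (G' ⧸ K) (e γ)).Finite := by
  obtain ⟨Φ, -⟩ := exists_equiv_fixedBy_quotient_congr C K e hK γ
  haveI := hfin.to_subtype
  exact Set.finite_coe_iff.1 (Finite.of_equiv _ Φ)

/-- Finiteness of the `⟨γ⟩`-orbit of the base coset transports along `e : G ≃* G′` with `g ∈ C ↔ e g ∈ K`. [cite: Kottwitz1986, §3] -/
theorem finite_range_pow_quotient_congr (hK : ∀ g : G, g ∈ C ↔ e g ∈ K) (γ : G) (horb : (Set.range fun n : ℕ => ((γ ^ n : G) : G ⧸ C)).Finite) :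
    (Set.range fun n : ℕ => (((e γ) ^ n : G') : G' ⧸ K)).Finite := by
  let Ψ : G ⧸ C → G' ⧸ K := Quotient.map' (e : G → G') fun a b hab => by
    rw [QuotientGroup.leftRel_apply] at hab ⊢
    rw [← map_inv, ← map_mul, ← hK]
    exact hab
  have hΨ : ∀ g : G, Ψ (g : G ⧸ C) = (e g : G' ⧸ K) := fun g => rfl
  refine (horb.image Ψ).subset ?_
  rintro x ⟨n, rfl⟩
  exact ⟨(γ ^ n : G), ⟨n, rfl⟩, by rw [hΨ, map_pow]⟩

end Congr

section Euler

variable (σ : E →+* E) (hσv : ∀ x : E, valuation E (σ x) = valuation E x) {ϖ : E} (hϖ : IsUniformizingElement ϖ)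
  {H : Matrix (Fin 2) (Fin 2) E} (hH : IsUnimodular₂ H)

include hσv hϖ hH in
/-- **THE ELLIPTIC EULER–POINCARÉ RELATION ON A MODEL `e : G ≃* U(σ, H)`.**  Levels `C, C′, I ≤ G` given by membership tests through `e`
(`g ∈ C ↔ e g ∈ GL₂(𝒪)`, `g ∈ C′ ↔ e g ∈ g₁ GL₂(𝒪) g₁⁻¹`, `g ∈ I ↔ g ∈ C ∧ g ∈ C′`); the (T3) hypotheses on `U(σ, H)` (`ϖL₀ ≤ latt g₁ ≤ L₀` a `ϖ`-modular
neighbour of the root; transitivity `hA hB hI`); finiteness of `Fix_γ(G⧸C)`, `Fix_γ(G⧸C′)` and of the `⟨γ⟩`-orbit of the base coset of `C` (all three hold for a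
regular elliptic `γ` on a locally compact model, ★ `finite_fixedBy_quotient_of_isClosed`).  Then
`Nat.card Fix_γ(G⧸C) + Nat.card Fix_γ(G⧸C′) = Nat.card Fix_γ(G⧸I) + 1`.  (★ (T3) `natCard_fixedBy_add_eq_natCard_fixedBy_inf_add_one` at `e γ`, transported
by ★ `natCard_fixedBy_quotient_congr`.)  With `G := (UnitaryGroup.cmDatum L 2 Φ₂).Local v`, `e := localNonsplitEquiv …`, `C := cmLocalIntegralLevel …`, `C′`, `I := C ⊓ C′`
this is the `hE` binder of ★ `Rogawski1990/RankOneEulerPoincareGlue` at a tame non-split place, both torus types at once.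
[cite: Kottwitz1988, §2] [cite: Kottwitz1986, §3] [cite: Serre1980Trees, I.6.1, II.1.1] [cite: Rogawski1990, §12.2 p. 176] -/
theorem natCard_fixedBy_add_eq_natCard_fixedBy_add_one_congr [IsDiscreteValuationRing 𝒪[E]] {G : Type*} [Group G]
    (e : G ≃* ↥(unitaryGroupOfForm σ H))
    (g₁ : GL (Fin 2) E) (hg₁ : IsModularLattice σ ϖ H (latt (g₁ : Matrix (Fin 2) (Fin 2) E)))
    (hadj₁ : scaleLattice ϖ (latt (1 : Matrix (Fin 2) (Fin 2) E)) ≤ latt (g₁ : Matrix (Fin 2) (Fin 2) E)) (hadj₂ : latt (g₁ : Matrix (Fin 2) (Fin 2) E) ≤ latt 1)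
    (hA : ∀ M : Submodule 𝒪[E] (Fin 2 → E), IsSelfDualLattice σ H M → ∃ u : ↥(unitaryGroupOfForm σ H), latt (((u : GL (Fin 2) E)) : Matrix (Fin 2) (Fin 2) E) = M)
    (hB : ∀ M : Submodule 𝒪[E] (Fin 2 → E), IsModularLattice σ ϖ H M →
      ∃ u : ↥(unitaryGroupOfForm σ H), latt (((u : GL (Fin 2) E) * g₁ : GL (Fin 2) E) : Matrix (Fin 2) (Fin 2) E) = M)
    (hI : ∀ M N : Submodule 𝒪[E] (Fin 2 → E), IsSelfDualLattice σ H M → IsModularLattice σ ϖ H N → scaleLattice ϖ M ≤ N → N ≤ M →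
      ∃ u : ↥(unitaryGroupOfForm σ H), latt (((u : GL (Fin 2) E)) : Matrix (Fin 2) (Fin 2) E) = M ∧
        latt (((u : GL (Fin 2) E) * g₁ : GL (Fin 2) E) : Matrix (Fin 2) (Fin 2) E) = N)
    (C C' I : Subgroup G)
    (hC : ∀ g : G, g ∈ C ↔ ((e g : ↥(unitaryGroupOfForm σ H)) : GL (Fin 2) E) ∈ glInt 2 E)
    (hC' : ∀ g : G, g ∈ C' ↔ ((e g : ↥(unitaryGroupOfForm σ H)) : GL (Fin 2) E) ∈ (glInt 2 E).map (MulAut.conj g₁).toMonoidHom)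
    (hI' : ∀ g : G, g ∈ I ↔ g ∈ C ∧ g ∈ C')
    (γ : G) (hCfin : (MulAction.fixedBy (G ⧸ C) γ).Finite) (hC'fin : (MulAction.fixedBy (G ⧸ C') γ).Finite)
    (horb : (Set.range fun n : ℕ => ((γ ^ n : G) : G ⧸ C)).Finite) :
    Nat.card (MulAction.fixedBy (G ⧸ C) γ) + Nat.card (MulAction.fixedBy (G ⧸ C') γ) = Nat.card (MulAction.fixedBy (G ⧸ I) γ) + 1 := by
  have hK : ∀ g : G, g ∈ C ↔ e g ∈ (glInt 2 E).subgroupOf (unitaryGroupOfForm σ H) := fun g => by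
    rw [hC, Subgroup.mem_subgroupOf]
  have hK' : ∀ g : G, g ∈ C' ↔ e g ∈ ((glInt 2 E).map (MulAut.conj g₁).toMonoidHom).subgroupOf (unitaryGroupOfForm σ H) := fun g => by
    rw [hC', Subgroup.mem_subgroupOf]
  have hKI : ∀ g : G, g ∈ I ↔ e g ∈ (glInt 2 E).subgroupOf (unitaryGroupOfForm σ H) ⊓ ((glInt 2 E).map (MulAut.conj g₁).toMonoidHom).subgroupOf (unitaryGroupOfForm σ H) :=
    fun g => by rw [hI', Subgroup.mem_inf, hK, hK']
  rw [natCard_fixedBy_quotient_congr C _ e hK γ, natCard_fixedBy_quotient_congr C' _ e hK' γ, natCard_fixedBy_quotient_congr I _ e hKI γ]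
  exact natCard_fixedBy_add_eq_natCard_fixedBy_inf_add_one σ hσv hϖ hH g₁ hg₁ hadj₁ hadj₂ hA hB hI (e γ)
    (finite_fixedBy_quotient_congr C _ e hK γ hCfin) (finite_fixedBy_quotient_congr C' _ e hK' γ hC'fin) (finite_range_pow_quotient_congr C _ e hK γ horb)

end Euler

end Literature.NumberTheory.Automorphic.HermitianLatticeTree

end
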